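import Summits.QuantumFields.YangMills.Theorems.FlatTubeReductionTwoProfileKernel
import Summits.QuantumFields.YangMills.Theorems.FlatTubeReductionCentralColourRemoval
import Summits.QuantumFields.YangMills.Theorems.FlatTubeReductionReweightedProfile
import Summits.QuantumFields.YangMills.Theorems.FlatTubeReductionMomentTransport
import Summits.QuantumFields.YangMills.Theorems.LuscherReductionTwistedTraceScalingBOCoreDefectPointwise
import HarnessLib

/-!
# Fibre factors of the `(C2)`-moments core bound: colour removal, homogeneity, and the reweighted two-profile kernel

Support file for the crux `NearFlatRatioLaw` (line `ratepack_v2`, stub `stub_hODpot_A`, step (R3a) of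
`Cruxes/NearFlatRatioLaw/Lines/ratepack-v7-moments-g18.md`).

The integrated core `L²` estimate `…CoreDefectOrbitMomentSq.defect_core_sq_integral_le_orbit_moments` leaves fibre factors
`F_{k,j} = ∫dπ(v) Ω₁(v̂) · ∫dc T[Ω‖x‖^{2k}, W·G^j](c⁻¹ oT(1,v) c; 1)` with a colour-rotation invariant output weight `Ω₁ ≤ Ω`
(`Ω₁ = 𝟙_in e^{-q} e^{-‖P_Γ·‖²/δg²}` of record), `G(g) = Σ_x ‖q(g_x) − 1‖²`.  `fibre_factor_le_reweighted` reduces them to the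
colour-localised BO kernel of the REWEIGHTED profile and weight at the identity slow points, with the full power gain:
`F_{k,j} ≤ β^{-(k+j)} · fpBOKernel β (Ω(1+β‖x‖²)^k) (W(1+βG)^j) 1 1` — colour removal (`…CentralColourRemoval`), monotonicity /
homogeneity of the fibre transfer in `(Ω, W)`, and the two-profile bound (`…TwoProfileKernel`).  The right side is the input of the
reference-moment machine (`…ReweightedProfile`, `…ReferenceMoments`): profile numbers, no logarithm.
-/

noncomputable section

open MeasureTheory Filter Topology Real
open scoped BigOperators
open Literature.MathematicalPhysics.QuantumFieldTheory
open Literature.MathematicalPhysics.QuantumLattice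

namespace Summit.QuantumFields.YangMills.Theorems.FemtoTransferGap.TwoLattice.ConstTube

open Summit.QuantumFields.YangMills.Theorems.FemtoTransferGap
open Summit.QuantumFields.YangMills.Theorems.FemtoTransferGap.TwoLattice
open Summit.QuantumFields.YangMills.Theorems.FemtoTransferGap.TwoLattice.Avg
open Summit.QuantumFields.YangMills.Theorems.FemtoTransferGap.TwoLattice.Stiff (LinkSpace)

variable {L : ℕ} [NeZero L]

/-! ## §1 Monotonicity and homogeneity of the fibre transfer in the profile and the weight -/

/-- **Monotone, homogeneous**: if `W g·Ω x ≤ a·W' g·Ω' x` pointwise (all data bounded measurable), then `T[Ω, W](U; u) ≤ a·T[Ω', W'](U; u)`. [folklore] -/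
theorem fpFibreTransfer_le_of_le (β : ℝ) {Ω Ω' : LinkSpace L → ℝ} (hΩm : Measurable Ω) (hΩ'm : Measurable Ω') {CΩ CΩ' : ℝ} (hCΩ : ∀ x, |Ω x| ≤ CΩ)
    (hCΩ' : ∀ x, |Ω' x| ≤ CΩ') {W W' : (Site 3 L → SU2) → ℝ} (hWm : Measurable W) (hW'm : Measurable W') {CW CW' : ℝ} (hCW : ∀ g, |W g| ≤ CW)
    (hCW' : ∀ g, |W' g| ≤ CW') {a : ℝ} (hle : ∀ (g : Site 3 L → SU2) (x : LinkSpace L), W g * Ω x ≤ a * (W' g * Ω' x))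
    (U : GaugeConfig 3 L SU2) (u : GaugeConfig 3 1 SU2) :
    fpFibreTransfer L β Ω W U u ≤ a * fpFibreTransfer L β Ω' W' U u := by
  haveI := isFiniteMeasure_orthoTransverse L
  unfold fpFibreTransfer
  rw [← integral_const_mul]
  obtain ⟨B, hB⟩ := abs_fpFibreTransfer_integrand_le (L := L) β hCΩ hCW U u
  obtain ⟨B', hB'⟩ := abs_fpFibreTransfer_integrand_le (L := L) β hCΩ' hCW' U u
  have hint : Integrable (fun p : (Edge 3 L → Fin 3 → ℝ) × (Site 3 L → SU2) =>
      W p.2 * transferKernel su2Rep β U (gaugeTransform p.2 (orthoTube L u p.1)) * Ω (linkEmbed L p.1)) ((orthoTransverse L).prod (gaugeMeasure L)) :=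
    integrable_of_measurable_abs_le _ (measurable_fpFibreTransfer_integrand β hΩm hWm U u) hB
  have hint' : Integrable (fun p : (Edge 3 L → Fin 3 → ℝ) × (Site 3 L → SU2) =>
      a * (W' p.2 * transferKernel su2Rep β U (gaugeTransform p.2 (orthoTube L u p.1)) * Ω' (linkEmbed L p.1))) ((orthoTransverse L).prod (gaugeMeasure L)) :=
    (integrable_of_measurable_abs_le _ (measurable_fpFibreTransfer_integrand β hΩ'm hW'm U u) hB').const_mul a
  refine integral_mono hint hint' fun p => ?_
  have hK := (transferKernel_pos su2Rep β U (gaugeTransform p.2 (orthoTube L u p.1))).le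
  have h := mul_le_mul_of_nonneg_left (hle p.2 (linkEmbed L p.1)) hK
  have e1 : W p.2 * transferKernel su2Rep β U (gaugeTransform p.2 (orthoTube L u p.1)) * Ω (linkEmbed L p.1) =
      transferKernel su2Rep β U (gaugeTransform p.2 (orthoTube L u p.1)) * (W p.2 * Ω (linkEmbed L p.1)) := by ring
  have e2 : a * (W' p.2 * transferKernel su2Rep β U (gaugeTransform p.2 (orthoTube L u p.1)) * Ω' (linkEmbed L p.1)) =
      transferKernel su2Rep β U (gaugeTransform p.2 (orthoTube L u p.1)) * (a * (W' p.2 * Ω' (linkEmbed L p.1))) := by ring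
  show W p.2 * transferKernel su2Rep β U (gaugeTransform p.2 (orthoTube L u p.1)) * Ω (linkEmbed L p.1) ≤
    a * (W' p.2 * transferKernel su2Rep β U (gaugeTransform p.2 (orthoTube L u p.1)) * Ω' (linkEmbed L p.1))
  rw [e1, e2]; exact h

/-- The power comparison `s^k ≤ β^{-k}·(1 + β s)^k` for `s ≥ 0`, `β > 0`. [folklore] -/
theorem pow_le_inv_pow_mul_one_add_pow {β s : ℝ} (hβ : 0 < β) (hs : 0 ≤ s) (k : ℕ) : s ^ k ≤ (β ^ k)⁻¹ * (1 + β * s) ^ k := by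
  rw [← inv_pow, ← mul_pow]
  refine pow_le_pow_left₀ hs ?_ k
  rw [mul_add, mul_one, ← mul_assoc, inv_mul_cancel₀ hβ.ne', one_mul]
  linarith [inv_pos.mpr hβ]

/-! ## §2 The fibre factor -/

/-- ★★★ **THE FIBRE FACTOR, REDUCED TO THE REWEIGHTED COLOUR-LOCALISED BO KERNEL**: `β > 0`; a profile `Ω` (bounded measurable,
`≥ 0`, supported in the capped balanced set with `‖x̂‖ ≤ R`); a bounded measurable weight `W ≥ 0`; an output weight `0 ≤ Ω₁ ≤ Ω`,
measurable and invariant under the global colour rotation; `k, j ∈ ℕ`.  Then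
`∫dπ(v) Ω₁(v̂)·∫dc T[Ω‖·‖^{2k}, W·G^j](c⁻¹ oT(1,v) c; 1) ≤ β^{-(k+j)}·fpBOKernel β (Ω(1+β‖·‖²)^k) (W(1+βG)^j) 1 1`. [cite: Luscher1983, §3] -/
theorem fibre_factor_le_reweighted {β : ℝ} (hβ : 0 < β) {Ω Ω₁ : LinkSpace L → ℝ} (hΩm : Measurable Ω) (hΩ₁m : Measurable Ω₁) {CΩ : ℝ}
    (hCΩ : ∀ x, |Ω x| ≤ CΩ) (hΩ0 : ∀ x, 0 ≤ Ω x) (hΩ₁0 : ∀ x, 0 ≤ Ω₁ x) (hΩ₁le : ∀ x, Ω₁ x ≤ Ω x)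
    (hΩ₁inv : ∀ (c : SU2) (x : LinkSpace L), Ω₁ (adL L c x) = Ω₁ x) {R : ℝ}
    (hΩt : ∀ v : Edge 3 L → Fin 3 → ℝ, Ω (linkEmbed L v) ≠ 0 → v ∈ capBalancedSet L ∧ ‖linkEmbed L v‖ ≤ R)
    {W : (Site 3 L → SU2) → ℝ} (hW : Measurable W) {CW : ℝ} (hCW : ∀ g, |W g| ≤ CW) (hW0 : ∀ g, 0 ≤ W g) (k j : ℕ) :
    ∫ v, Ω₁ (linkEmbed L v) *
        ∫ c, fpFibreTransfer L β (fun x => Ω x * (‖x‖ ^ 2) ^ k) (fun g => W g * (∑ x, ‖su2Quat (g x) - 1‖ ^ 2) ^ j)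
          (gaugeTransform (fun _ : Site 3 L => c⁻¹) (orthoTube L 1 v)) 1 ∂haarProbability SU2 ∂orthoTransverse L ≤
      (β ^ (k + j))⁻¹ * fpBOKernel L β (fun x => Ω x * (1 + β * ‖x‖ ^ 2) ^ k) (fun g => W g * (1 + β * ∑ x, ‖su2Quat (g x) - 1‖ ^ 2) ^ j) 1 1 := by
  haveI : SecondCountableTopology SU2 := secondCountableTopology_su2
  haveI := isFiniteMeasure_orthoTransverse L
  have hβ0 : 0 ≤ β := hβ.le
  -- data facts
  have hCΩ0 : 0 ≤ CΩ := (abs_nonneg _).trans (hCΩ 0)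
  have hCW0 : 0 ≤ CW := (abs_nonneg _).trans (hCW 1)
  have hΩR : ∀ x : LinkSpace L, Ω x ≠ 0 → ‖x‖ ≤ R := fun x hx => by
    have hs := hΩt (fun e a => x (e, a)) (by rw [RateTube.linkEmbed_curry]; exact hx)
    rw [RateTube.linkEmbed_curry] at hs; exact hs.2
  obtain ⟨hΩkm, hΩk0, hΩkb, -⟩ := RateTube.reweight_props (L := L) hβ0 hΩm hCΩ hΩ0 hΩt k
  have hΩpm : Measurable fun x : LinkSpace L => Ω x * (‖x‖ ^ 2) ^ k := hΩm.mul ((measurable_norm.pow_const 2).pow_const k)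
  have hΩpb : ∀ x : LinkSpace L, |Ω x * (‖x‖ ^ 2) ^ k| ≤ CΩ * (R ^ 2) ^ k := fun x => by
    by_cases hx : Ω x = 0
    · rw [hx, zero_mul, abs_zero]; positivity
    · rw [abs_mul, abs_of_nonneg (by positivity : (0 : ℝ) ≤ (‖x‖ ^ 2) ^ k)]
      exact mul_le_mul (hCΩ x) (pow_le_pow_left₀ (sq_nonneg _) (pow_le_pow_left₀ (norm_nonneg _) (hΩR x hx) 2) k) (by positivity) hCΩ0
  have hG := fun g : Site 3 L → SU2 => gaugeDevSq_mem g
  have hWpm : Measurable fun g : Site 3 L → SU2 => W g * (∑ x, ‖su2Quat (g x) - 1‖ ^ 2) ^ j := hW.mul (measurable_gaugeDevSq.pow_const j)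
  have hWpb : ∀ g : Site 3 L → SU2, |W g * (∑ x, ‖su2Quat (g x) - 1‖ ^ 2) ^ j| ≤ CW * (4 * Fintype.card (Site 3 L)) ^ j := fun g => by
    rw [abs_mul, abs_of_nonneg (pow_nonneg (hG g).1 j)]
    exact mul_le_mul (hCW g) (pow_le_pow_left₀ (hG g).1 (hG g).2 j) (pow_nonneg (hG g).1 j) hCW0
  have hWrm : Measurable fun g : Site 3 L → SU2 => W g * (1 + β * ∑ x, ‖su2Quat (g x) - 1‖ ^ 2) ^ j :=
    hW.mul ((measurable_const.add (measurable_gaugeDevSq.const_mul β)).pow_const j)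
  have hWr0 : ∀ g : Site 3 L → SU2, 0 ≤ W g * (1 + β * ∑ x, ‖su2Quat (g x) - 1‖ ^ 2) ^ j := fun g =>
    mul_nonneg (hW0 g) (pow_nonneg (by nlinarith [(hG g).1]) j)
  have hWrb : ∀ g : Site 3 L → SU2, |W g * (1 + β * ∑ x, ‖su2Quat (g x) - 1‖ ^ 2) ^ j| ≤ CW * (1 + β * (4 * Fintype.card (Site 3 L))) ^ j := fun g => by
    have h1 : 0 ≤ 1 + β * ∑ x, ‖su2Quat (g x) - 1‖ ^ 2 := by nlinarith [(hG g).1]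
    rw [abs_mul, abs_of_nonneg (pow_nonneg h1 j)]
    exact mul_le_mul (hCW g) (pow_le_pow_left₀ h1 (by nlinarith [(hG g).2]) j) (pow_nonneg h1 j) hCW0
  have hΩ₁b : ∀ x, |Ω₁ x| ≤ CΩ := fun x => by rw [abs_of_nonneg (hΩ₁0 x)]; exact (hΩ₁le x).trans ((le_abs_self _).trans (hCΩ x))
  -- Step 1: the pointwise comparison `T[Ω‖·‖^{2k}, W G^j] ≤ β^{-(k+j)} T[Ω_k, W_j]`
  have hpt : ∀ U : GaugeConfig 3 L SU2, fpFibreTransfer L β (fun x => Ω x * (‖x‖ ^ 2) ^ k) (fun g => W g * (∑ x, ‖su2Quat (g x) - 1‖ ^ 2) ^ j) U 1 ≤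
      (β ^ (k + j))⁻¹ * fpFibreTransfer L β (fun x => Ω x * (1 + β * ‖x‖ ^ 2) ^ k) (fun g => W g * (1 + β * ∑ x, ‖su2Quat (g x) - 1‖ ^ 2) ^ j) U 1 := by
    intro U
    refine fpFibreTransfer_le_of_le β hΩpm hΩkm hΩpb hΩkb hWpm hWrm hWpb hWrb (fun g x => ?_) U 1
    have h1 := pow_le_inv_pow_mul_one_add_pow hβ (sq_nonneg ‖x‖) k
    have h2 := pow_le_inv_pow_mul_one_add_pow hβ (hG g).1 j
    have h3 := mul_le_mul h2 h1 (pow_nonneg (sq_nonneg _) k) (mul_nonneg (inv_nonneg.mpr (pow_nonneg hβ0 j)) (pow_nonneg (by nlinarith [(hG g).1]) j))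
    have h4 := mul_le_mul_of_nonneg_left h3 (mul_nonneg (hW0 g) (hΩ0 x))
    have e : (β ^ (k + j))⁻¹ = (β ^ j)⁻¹ * (β ^ k)⁻¹ := by rw [pow_add, mul_inv, mul_comm]
    rw [e]
    calc W g * (∑ x, ‖su2Quat (g x) - 1‖ ^ 2) ^ j * (Ω x * (‖x‖ ^ 2) ^ k)
        = W g * Ω x * ((∑ x, ‖su2Quat (g x) - 1‖ ^ 2) ^ j * (‖x‖ ^ 2) ^ k) := by ring
      _ ≤ W g * Ω x * ((β ^ j)⁻¹ * (1 + β * ∑ x, ‖su2Quat (g x) - 1‖ ^ 2) ^ j * ((β ^ k)⁻¹ * (1 + β * ‖x‖ ^ 2) ^ k)) := h4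
      _ = (β ^ j)⁻¹ * (β ^ k)⁻¹ * (W g * (1 + β * ∑ x, ‖su2Quat (g x) - 1‖ ^ 2) ^ j * (Ω x * (1 + β * ‖x‖ ^ 2) ^ k)) := by ring
  -- Step 2: Fubini and colour removal
  obtain ⟨BF, hBF⟩ := abs_fpFibreTransfer_le' (L := L) β hΩpb hWpb
  have hFm2 : Measurable fun z : (Edge 3 L → Fin 3 → ℝ) × SU2 =>
      Ω₁ (linkEmbed L z.1) * fpFibreTransfer L β (fun x => Ω x * (‖x‖ ^ 2) ^ k) (fun g => W g * (∑ x, ‖su2Quat (g x) - 1‖ ^ 2) ^ j)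
        (gaugeTransform (fun _ : Site 3 L => z.2⁻¹) (orthoTube L 1 z.1)) 1 := by
    have h1 : Measurable fun z : (Edge 3 L → Fin 3 → ℝ) × SU2 => gaugeTransform (fun _ : Site 3 L => z.2⁻¹) (orthoTube L 1 z.1) := by
      have ha : Measurable fun z : (Edge 3 L → Fin 3 → ℝ) × SU2 => (orthoTube L 1 z.1, z.2⁻¹) :=
        ((measurable_orthoTube_right (L := L) 1).comp measurable_fst).prodMk measurable_snd.inv
      have h := (measurable_constGaugeAction (L := L)).comp ha
      simpa only [Function.comp_def] using h
    have h2 := (measurable_fpFibreTransfer_out (L := L) β hΩpm hWpm 1).comp h1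
    exact (hΩ₁m.comp ((measurable_linkEmbed L).comp measurable_fst)).mul (by simpa only [Function.comp_def] using h2)
  have hFint : Integrable (fun z : (Edge 3 L → Fin 3 → ℝ) × SU2 =>
      Ω₁ (linkEmbed L z.1) * fpFibreTransfer L β (fun x => Ω x * (‖x‖ ^ 2) ^ k) (fun g => W g * (∑ x, ‖su2Quat (g x) - 1‖ ^ 2) ^ j)
        (gaugeTransform (fun _ : Site 3 L => z.2⁻¹) (orthoTube L 1 z.1)) 1) ((orthoTransverse L).prod (haarProbability SU2)) :=
    integrable_of_measurable_abs_le _ hFm2 (C := CΩ * BF) fun z => by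
      rw [abs_mul]; exact mul_le_mul (hΩ₁b _) (hBF _ _) (abs_nonneg _) hCΩ0
  have hswap : ∫ v, Ω₁ (linkEmbed L v) * ∫ c, fpFibreTransfer L β (fun x => Ω x * (‖x‖ ^ 2) ^ k) (fun g => W g * (∑ x, ‖su2Quat (g x) - 1‖ ^ 2) ^ j)
        (gaugeTransform (fun _ : Site 3 L => c⁻¹) (orthoTube L 1 v)) 1 ∂haarProbability SU2 ∂orthoTransverse L =
      ∫ c, ∫ v, Ω₁ (linkEmbed L v) * fpFibreTransfer L β (fun x => Ω x * (‖x‖ ^ 2) ^ k) (fun g => W g * (∑ x, ‖su2Quat (g x) - 1‖ ^ 2) ^ j)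
        (gaugeTransform (fun _ : Site 3 L => c⁻¹) (orthoTube L 1 v)) 1 ∂orthoTransverse L ∂haarProbability SU2 := by
    rw [← integral_integral_swap hFint]
    exact integral_congr_ae (ae_of_all _ fun v => by dsimp only; rw [integral_const_mul])
  rw [hswap]
  have hcol : ∀ c : SU2, ∫ v, Ω₁ (linkEmbed L v) * fpFibreTransfer L β (fun x => Ω x * (‖x‖ ^ 2) ^ k) (fun g => W g * (∑ x, ‖su2Quat (g x) - 1‖ ^ 2) ^ j)
        (gaugeTransform (fun _ : Site 3 L => c⁻¹) (orthoTube L 1 v)) 1 ∂orthoTransverse L =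
      ∫ v, Ω₁ (linkEmbed L v) * fpFibreTransfer L β (fun x => Ω x * (‖x‖ ^ 2) ^ k) (fun g => W g * (∑ x, ‖su2Quat (g x) - 1‖ ^ 2) ^ j) (orthoTube L 1 v) 1
        ∂orthoTransverse L := fun c =>
    integral_mul_fpFibreTransfer_conj_eq β hΩpm hWpm c (G := fun v => Ω₁ (linkEmbed L v)) (hΩ₁m.comp (measurable_linkEmbed L))
      fun v => by show Ω₁ (linkEmbed L (colourRotate L (fun _ => c⁻¹) v)) = Ω₁ (linkEmbed L v); rw [linkEmbed_colourRotate_const, hΩ₁inv]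
  rw [integral_congr_ae (ae_of_all _ hcol), integral_const, smul_eq_mul, probReal_univ, one_mul]
  -- Step 3: the pointwise comparison under the integral, then the two-profile bound
  obtain ⟨BR, hBR⟩ := abs_fpFibreTransfer_le' (L := L) β hΩkb hWrb
  have hI1 : Integrable (fun v => Ω₁ (linkEmbed L v) * fpFibreTransfer L β (fun x => Ω x * (‖x‖ ^ 2) ^ k) (fun g => W g * (∑ x, ‖su2Quat (g x) - 1‖ ^ 2) ^ j)
      (orthoTube L 1 v) 1) (orthoTransverse L) :=
    integrable_of_measurable_abs_le _ ((hΩ₁m.comp (measurable_linkEmbed L)).mul ((measurable_fpFibreTransfer_out (L := L) β hΩpm hWpm 1).comp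
      (measurable_orthoTube_right (L := L) 1))) (C := CΩ * BF) fun v => by rw [abs_mul]; exact mul_le_mul (hΩ₁b _) (hBF _ _) (abs_nonneg _) hCΩ0
  have hI2' : Integrable (fun v => Ω₁ (linkEmbed L v) * fpFibreTransfer L β (fun x => Ω x * (1 + β * ‖x‖ ^ 2) ^ k)
      (fun g => W g * (1 + β * ∑ x, ‖su2Quat (g x) - 1‖ ^ 2) ^ j) (orthoTube L 1 v) 1) (orthoTransverse L) :=
    integrable_of_measurable_abs_le _ ((hΩ₁m.comp (measurable_linkEmbed L)).mul ((measurable_fpFibreTransfer_out (L := L) β hΩkm hWrm 1).comp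
      (measurable_orthoTube_right (L := L) 1))) (C := CΩ * BR) fun v => by
        rw [abs_mul]; exact mul_le_mul (hΩ₁b _) (hBR _ _) (abs_nonneg _) hCΩ0
  have hI2 : Integrable (fun v => (β ^ (k + j))⁻¹ * (Ω₁ (linkEmbed L v) * fpFibreTransfer L β (fun x => Ω x * (1 + β * ‖x‖ ^ 2) ^ k)
      (fun g => W g * (1 + β * ∑ x, ‖su2Quat (g x) - 1‖ ^ 2) ^ j) (orthoTube L 1 v) 1)) (orthoTransverse L) := hI2'.const_mul _
  have step := integral_mono hI1 hI2 fun v => by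
    have h := mul_le_mul_of_nonneg_left (hpt (orthoTube L 1 v)) (hΩ₁0 (linkEmbed L v))
    show Ω₁ (linkEmbed L v) * fpFibreTransfer L β (fun x => Ω x * (‖x‖ ^ 2) ^ k) (fun g => W g * (∑ x, ‖su2Quat (g x) - 1‖ ^ 2) ^ j) (orthoTube L 1 v) 1 ≤
      (β ^ (k + j))⁻¹ * (Ω₁ (linkEmbed L v) * fpFibreTransfer L β (fun x => Ω x * (1 + β * ‖x‖ ^ 2) ^ k)
        (fun g => W g * (1 + β * ∑ x, ‖su2Quat (g x) - 1‖ ^ 2) ^ j) (orthoTube L 1 v) 1)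
    linarith
  refine step.trans ?_
  rw [integral_const_mul]
  refine mul_le_mul_of_nonneg_left ?_ (inv_nonneg.mpr (pow_nonneg hβ0 _))
  have hΩ₁k : ∀ x, Ω₁ x ≤ Ω x * (1 + β * ‖x‖ ^ 2) ^ k := fun x =>
    (hΩ₁le x).trans (le_mul_of_one_le_right (hΩ0 x) (one_le_pow₀ (by nlinarith [sq_nonneg ‖x‖])))
  exact integral_profile_mul_fpFibreTransfer_le_fpBOKernel β hΩ₁m hΩkm hΩkm hΩ₁b hΩkb hΩkb hΩ₁0 hΩk0 hΩ₁k (fun x => le_rfl) hWrm hWrb hWr0 1 1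

/-! ## §3 The fibre factor with an output moment -/

/-- **Homogeneity** of the fibre transfer in the profile. [folklore] -/
theorem fpFibreTransfer_const_mul (β c : ℝ) (Ω : LinkSpace L → ℝ) (W : (Site 3 L → SU2) → ℝ) (U : GaugeConfig 3 L SU2) (u : GaugeConfig 3 1 SU2) :
    fpFibreTransfer L β (fun x => c * Ω x) W U u = c * fpFibreTransfer L β Ω W U u := by
  unfold fpFibreTransfer; rw [← integral_const_mul]; exact integral_congr_ae (ae_of_all _ fun p => by ring)

/-- ★★★ **THE FIBRE FACTOR WITH AN OUTPUT MOMENT**: as `fibre_factor_le_reweighted`, with the output weight `Ω₁(v̂)·‖v̂‖^{2a}` and a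
common reweighting exponent `K ≥ a, k`:
`∫dπ(v) Ω₁(v̂)‖v̂‖^{2a}·∫dc T[Ω‖·‖^{2k}, W·G^j](c⁻¹ oT(1,v) c; 1) ≤ β^{-(a+k+j)}·fpBOKernel β (Ω(1+β‖·‖²)^K) (W(1+βG)^j) 1 1` — the output
fibre moments `‖x'‖^{2a}` of the Cauchy–Schwarz coefficient `(c₀ + c₁‖x'‖² + 3c₂‖x'‖⁴)²` are profile moments too (no `R_in^{2a}`, no logarithm).
[cite: Luscher1983, §3] -/
theorem fibre_factor_moment_le_reweighted {β : ℝ} (hβ : 0 < β) {Ω Ω₁ : LinkSpace L → ℝ} (hΩm : Measurable Ω) (hΩ₁m : Measurable Ω₁) {CΩ : ℝ}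
    (hCΩ : ∀ x, |Ω x| ≤ CΩ) (hΩ0 : ∀ x, 0 ≤ Ω x) (hΩ₁0 : ∀ x, 0 ≤ Ω₁ x) (hΩ₁le : ∀ x, Ω₁ x ≤ Ω x)
    (hΩ₁inv : ∀ (c : SU2) (x : LinkSpace L), Ω₁ (adL L c x) = Ω₁ x) {R : ℝ}
    (hΩt : ∀ v : Edge 3 L → Fin 3 → ℝ, Ω (linkEmbed L v) ≠ 0 → v ∈ capBalancedSet L ∧ ‖linkEmbed L v‖ ≤ R)
    {W : (Site 3 L → SU2) → ℝ} (hW : Measurable W) {CW : ℝ} (hCW : ∀ g, |W g| ≤ CW) (hW0 : ∀ g, 0 ≤ W g) {a k K : ℕ} (haK : a ≤ K) (hkK : k ≤ K) (j : ℕ) :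
    ∫ v, Ω₁ (linkEmbed L v) * (‖linkEmbed L v‖ ^ 2) ^ a *
        ∫ c, fpFibreTransfer L β (fun x => Ω x * (‖x‖ ^ 2) ^ k) (fun g => W g * (∑ x, ‖su2Quat (g x) - 1‖ ^ 2) ^ j)
          (gaugeTransform (fun _ : Site 3 L => c⁻¹) (orthoTube L 1 v)) 1 ∂haarProbability SU2 ∂orthoTransverse L ≤
      (β ^ (a + k + j))⁻¹ * fpBOKernel L β (fun x => Ω x * (1 + β * ‖x‖ ^ 2) ^ K) (fun g => W g * (1 + β * ∑ x, ‖su2Quat (g x) - 1‖ ^ 2) ^ j) 1 1 := by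
  haveI : SecondCountableTopology SU2 := secondCountableTopology_su2
  haveI := isFiniteMeasure_orthoTransverse L
  have hβ0 : 0 ≤ β := hβ.le
  have hCΩ0 : 0 ≤ CΩ := (abs_nonneg _).trans (hCΩ 0)
  have hCW0 : 0 ≤ CW := (abs_nonneg _).trans (hCW 1)
  have hΩR : ∀ x : LinkSpace L, Ω x ≠ 0 → ‖x‖ ≤ R := fun x hx => by
    have hs := hΩt (fun e a => x (e, a)) (by rw [RateTube.linkEmbed_curry]; exact hx)
    rw [RateTube.linkEmbed_curry] at hs; exact hs.2
  obtain ⟨hΩKm, hΩK0, hΩKb, -⟩ := RateTube.reweight_props (L := L) hβ0 hΩm hCΩ hΩ0 hΩt K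
  have hpowb : ∀ (n : ℕ) (x : LinkSpace L), Ω x ≠ 0 → (‖x‖ ^ 2) ^ n ≤ (R ^ 2) ^ n := fun n x hx =>
    pow_le_pow_left₀ (sq_nonneg _) (pow_le_pow_left₀ (norm_nonneg _) (hΩR x hx) 2) n
  have hΩpm : Measurable fun x : LinkSpace L => Ω x * (‖x‖ ^ 2) ^ k := hΩm.mul ((measurable_norm.pow_const 2).pow_const k)
  have hΩpb : ∀ x : LinkSpace L, |Ω x * (‖x‖ ^ 2) ^ k| ≤ CΩ * (R ^ 2) ^ k := fun x => by
    by_cases hx : Ω x = 0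
    · rw [hx, zero_mul, abs_zero]; positivity
    · rw [abs_mul, abs_of_nonneg (by positivity : (0 : ℝ) ≤ (‖x‖ ^ 2) ^ k)]
      exact mul_le_mul (hCΩ x) (hpowb k x hx) (by positivity) hCΩ0
  have hG := fun g : Site 3 L → SU2 => gaugeDevSq_mem g
  have hWpm : Measurable fun g : Site 3 L → SU2 => W g * (∑ x, ‖su2Quat (g x) - 1‖ ^ 2) ^ j := hW.mul (measurable_gaugeDevSq.pow_const j)
  have hWpb : ∀ g : Site 3 L → SU2, |W g * (∑ x, ‖su2Quat (g x) - 1‖ ^ 2) ^ j| ≤ CW * (4 * Fintype.card (Site 3 L)) ^ j := fun g => by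
    rw [abs_mul, abs_of_nonneg (pow_nonneg (hG g).1 j)]
    exact mul_le_mul (hCW g) (pow_le_pow_left₀ (hG g).1 (hG g).2 j) (pow_nonneg (hG g).1 j) hCW0
  have hWrm : Measurable fun g : Site 3 L → SU2 => W g * (1 + β * ∑ x, ‖su2Quat (g x) - 1‖ ^ 2) ^ j :=
    hW.mul ((measurable_const.add (measurable_gaugeDevSq.const_mul β)).pow_const j)
  have hWr0 : ∀ g : Site 3 L → SU2, 0 ≤ W g * (1 + β * ∑ x, ‖su2Quat (g x) - 1‖ ^ 2) ^ j := fun g =>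
    mul_nonneg (hW0 g) (pow_nonneg (by nlinarith [(hG g).1]) j)
  have hWrb : ∀ g : Site 3 L → SU2, |W g * (1 + β * ∑ x, ‖su2Quat (g x) - 1‖ ^ 2) ^ j| ≤ CW * (1 + β * (4 * Fintype.card (Site 3 L))) ^ j := fun g => by
    have h1 : 0 ≤ 1 + β * ∑ x, ‖su2Quat (g x) - 1‖ ^ 2 := by nlinarith [(hG g).1]
    rw [abs_mul, abs_of_nonneg (pow_nonneg h1 j)]
    exact mul_le_mul (hCW g) (pow_le_pow_left₀ h1 (by nlinarith [(hG g).2]) j) (pow_nonneg h1 j) hCW0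
  -- the output weight with its moment
  obtain ⟨Ωa, hΩa⟩ : ∃ Ωa : LinkSpace L → ℝ, Ωa = fun x => Ω₁ x * (‖x‖ ^ 2) ^ a := ⟨_, rfl⟩
  have hΩam : Measurable Ωa := by rw [hΩa]; exact hΩ₁m.mul ((measurable_norm.pow_const 2).pow_const a)
  have hΩa0 : ∀ x, 0 ≤ Ωa x := fun x => by rw [hΩa]; exact mul_nonneg (hΩ₁0 x) (by positivity)
  have hΩab : ∀ x, |Ωa x| ≤ CΩ * (R ^ 2) ^ a := fun x => by
    rw [hΩa]; dsimp only
    by_cases hx : Ω x = 0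
    · have h0 : Ω₁ x = 0 := le_antisymm ((hΩ₁le x).trans hx.le) (hΩ₁0 x)
      rw [h0, zero_mul, abs_zero]; positivity
    · rw [abs_mul, abs_of_nonneg (by positivity : (0 : ℝ) ≤ (‖x‖ ^ 2) ^ a), abs_of_nonneg (hΩ₁0 x)]
      exact mul_le_mul ((hΩ₁le x).trans ((le_abs_self _).trans (hCΩ x))) (hpowb a x hx) (by positivity) hCΩ0
  have hΩainv : ∀ (c : SU2) (x : LinkSpace L), Ωa (adL L c x) = Ωa x := fun c x => by
    rw [hΩa]; dsimp only; rw [hΩ₁inv, (adL L c).norm_map]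
  -- the comparisons `Ωa ≤ β^{-a} Ω_K`, `Ω‖·‖^{2k} ≤ β^{-k} Ω_K`
  have hmono : ∀ (n : ℕ) (x : LinkSpace L), n ≤ K → (‖x‖ ^ 2) ^ n ≤ (β ^ n)⁻¹ * (1 + β * ‖x‖ ^ 2) ^ K := fun n x hn =>
    (pow_le_inv_pow_mul_one_add_pow hβ (sq_nonneg ‖x‖) n).trans
      (mul_le_mul_of_nonneg_left (pow_le_pow_right₀ (by nlinarith [sq_nonneg ‖x‖]) hn) (inv_nonneg.mpr (pow_nonneg hβ0 n)))
  have hΩaK : ∀ x, Ωa x ≤ (β ^ a)⁻¹ * (Ω x * (1 + β * ‖x‖ ^ 2) ^ K) := fun x => by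
    rw [hΩa]; dsimp only
    calc Ω₁ x * (‖x‖ ^ 2) ^ a ≤ Ω x * ((β ^ a)⁻¹ * (1 + β * ‖x‖ ^ 2) ^ K) := mul_le_mul (hΩ₁le x) (hmono a x haK) (by positivity) (hΩ0 x)
      _ = (β ^ a)⁻¹ * (Ω x * (1 + β * ‖x‖ ^ 2) ^ K) := by ring
  -- Step 1: pointwise `T[Ω‖·‖^{2k}, W G^j] ≤ β^{-(k+j)} T[Ω_K, W_j]`
  have hpt : ∀ U : GaugeConfig 3 L SU2, fpFibreTransfer L β (fun x => Ω x * (‖x‖ ^ 2) ^ k) (fun g => W g * (∑ x, ‖su2Quat (g x) - 1‖ ^ 2) ^ j) U 1 ≤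
      (β ^ (k + j))⁻¹ * fpFibreTransfer L β (fun x => Ω x * (1 + β * ‖x‖ ^ 2) ^ K) (fun g => W g * (1 + β * ∑ x, ‖su2Quat (g x) - 1‖ ^ 2) ^ j) U 1 := by
    intro U
    refine fpFibreTransfer_le_of_le β hΩpm hΩKm hΩpb hΩKb hWpm hWrm hWpb hWrb (fun g x => ?_) U 1
    have h1 := hmono k x hkK
    have h2 := pow_le_inv_pow_mul_one_add_pow hβ (hG g).1 j
    have h3 := mul_le_mul h2 h1 (pow_nonneg (sq_nonneg _) k) (mul_nonneg (inv_nonneg.mpr (pow_nonneg hβ0 j)) (pow_nonneg (by nlinarith [(hG g).1]) j))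
    have h4 := mul_le_mul_of_nonneg_left h3 (mul_nonneg (hW0 g) (hΩ0 x))
    have e : (β ^ (k + j))⁻¹ = (β ^ j)⁻¹ * (β ^ k)⁻¹ := by rw [pow_add, mul_inv, mul_comm]
    rw [e]
    calc W g * (∑ x, ‖su2Quat (g x) - 1‖ ^ 2) ^ j * (Ω x * (‖x‖ ^ 2) ^ k)
        = W g * Ω x * ((∑ x, ‖su2Quat (g x) - 1‖ ^ 2) ^ j * (‖x‖ ^ 2) ^ k) := by ring
      _ ≤ W g * Ω x * ((β ^ j)⁻¹ * (1 + β * ∑ x, ‖su2Quat (g x) - 1‖ ^ 2) ^ j * ((β ^ k)⁻¹ * (1 + β * ‖x‖ ^ 2) ^ K)) := h4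
      _ = (β ^ j)⁻¹ * (β ^ k)⁻¹ * (W g * (1 + β * ∑ x, ‖su2Quat (g x) - 1‖ ^ 2) ^ j * (Ω x * (1 + β * ‖x‖ ^ 2) ^ K)) := by ring
  -- Step 2: Fubini and colour removal for the output weight `Ωa`
  obtain ⟨BF, hBF⟩ := abs_fpFibreTransfer_le' (L := L) β hΩpb hWpb
  have hCa0 : 0 ≤ CΩ * (R ^ 2) ^ a := (abs_nonneg _).trans (hΩab 0)
  have hFm2 : Measurable fun z : (Edge 3 L → Fin 3 → ℝ) × SU2 =>
      Ωa (linkEmbed L z.1) * fpFibreTransfer L β (fun x => Ω x * (‖x‖ ^ 2) ^ k) (fun g => W g * (∑ x, ‖su2Quat (g x) - 1‖ ^ 2) ^ j)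
        (gaugeTransform (fun _ : Site 3 L => z.2⁻¹) (orthoTube L 1 z.1)) 1 := by
    have h1 : Measurable fun z : (Edge 3 L → Fin 3 → ℝ) × SU2 => gaugeTransform (fun _ : Site 3 L => z.2⁻¹) (orthoTube L 1 z.1) := by
      have ha : Measurable fun z : (Edge 3 L → Fin 3 → ℝ) × SU2 => (orthoTube L 1 z.1, z.2⁻¹) :=
        ((measurable_orthoTube_right (L := L) 1).comp measurable_fst).prodMk measurable_snd.inv
      have h := (measurable_constGaugeAction (L := L)).comp ha
      simpa only [Function.comp_def] using h
    have h2 := (measurable_fpFibreTransfer_out (L := L) β hΩpm hWpm 1).comp h1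
    exact (hΩam.comp ((measurable_linkEmbed L).comp measurable_fst)).mul (by simpa only [Function.comp_def] using h2)
  have hFint : Integrable (fun z : (Edge 3 L → Fin 3 → ℝ) × SU2 =>
      Ωa (linkEmbed L z.1) * fpFibreTransfer L β (fun x => Ω x * (‖x‖ ^ 2) ^ k) (fun g => W g * (∑ x, ‖su2Quat (g x) - 1‖ ^ 2) ^ j)
        (gaugeTransform (fun _ : Site 3 L => z.2⁻¹) (orthoTube L 1 z.1)) 1) ((orthoTransverse L).prod (haarProbability SU2)) :=
    integrable_of_measurable_abs_le _ hFm2 (C := CΩ * (R ^ 2) ^ a * BF) fun z => by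
      rw [abs_mul]; exact mul_le_mul (hΩab _) (hBF _ _) (abs_nonneg _) hCa0
  have hLHS : ∫ v, Ω₁ (linkEmbed L v) * (‖linkEmbed L v‖ ^ 2) ^ a *
        ∫ c, fpFibreTransfer L β (fun x => Ω x * (‖x‖ ^ 2) ^ k) (fun g => W g * (∑ x, ‖su2Quat (g x) - 1‖ ^ 2) ^ j)
          (gaugeTransform (fun _ : Site 3 L => c⁻¹) (orthoTube L 1 v)) 1 ∂haarProbability SU2 ∂orthoTransverse L =
      ∫ c, ∫ v, Ωa (linkEmbed L v) * fpFibreTransfer L β (fun x => Ω x * (‖x‖ ^ 2) ^ k) (fun g => W g * (∑ x, ‖su2Quat (g x) - 1‖ ^ 2) ^ j)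
        (gaugeTransform (fun _ : Site 3 L => c⁻¹) (orthoTube L 1 v)) 1 ∂orthoTransverse L ∂haarProbability SU2 := by
    rw [← integral_integral_swap hFint]
    exact integral_congr_ae (ae_of_all _ fun v => by rw [hΩa]; dsimp only; rw [integral_const_mul])
  rw [hLHS]
  have hcol : ∀ c : SU2, ∫ v, Ωa (linkEmbed L v) * fpFibreTransfer L β (fun x => Ω x * (‖x‖ ^ 2) ^ k) (fun g => W g * (∑ x, ‖su2Quat (g x) - 1‖ ^ 2) ^ j)
        (gaugeTransform (fun _ : Site 3 L => c⁻¹) (orthoTube L 1 v)) 1 ∂orthoTransverse L =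
      ∫ v, Ωa (linkEmbed L v) * fpFibreTransfer L β (fun x => Ω x * (‖x‖ ^ 2) ^ k) (fun g => W g * (∑ x, ‖su2Quat (g x) - 1‖ ^ 2) ^ j) (orthoTube L 1 v) 1
        ∂orthoTransverse L := fun c =>
    integral_mul_fpFibreTransfer_conj_eq β hΩpm hWpm c (G := fun v => Ωa (linkEmbed L v)) (hΩam.comp (measurable_linkEmbed L))
      fun v => by show Ωa (linkEmbed L (colourRotate L (fun _ => c⁻¹) v)) = Ωa (linkEmbed L v); rw [linkEmbed_colourRotate_const, hΩainv]
  rw [integral_congr_ae (ae_of_all _ hcol), integral_const, smul_eq_mul, probReal_univ, one_mul]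
  -- Step 3: the pointwise comparisons under the integral, then the two-profile bound
  obtain ⟨BR, hBR⟩ := abs_fpFibreTransfer_le' (L := L) β hΩKb hWrb
  have hI1 : Integrable (fun v => Ωa (linkEmbed L v) * fpFibreTransfer L β (fun x => Ω x * (‖x‖ ^ 2) ^ k) (fun g => W g * (∑ x, ‖su2Quat (g x) - 1‖ ^ 2) ^ j)
      (orthoTube L 1 v) 1) (orthoTransverse L) :=
    integrable_of_measurable_abs_le _ ((hΩam.comp (measurable_linkEmbed L)).mul ((measurable_fpFibreTransfer_out (L := L) β hΩpm hWpm 1).comp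
      (measurable_orthoTube_right (L := L) 1))) (C := CΩ * (R ^ 2) ^ a * BF) fun v => by rw [abs_mul]; exact mul_le_mul (hΩab _) (hBF _ _) (abs_nonneg _) hCa0
  have hI3' : Integrable (fun v => Ω (linkEmbed L v) * (1 + β * ‖linkEmbed L v‖ ^ 2) ^ K * fpFibreTransfer L β (fun x => Ω x * (1 + β * ‖x‖ ^ 2) ^ K)
      (fun g => W g * (1 + β * ∑ x, ‖su2Quat (g x) - 1‖ ^ 2) ^ j) (orthoTube L 1 v) 1) (orthoTransverse L) :=
    integrable_of_measurable_abs_le _ ((hΩKm.comp (measurable_linkEmbed L)).mul ((measurable_fpFibreTransfer_out (L := L) β hΩKm hWrm 1).comp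
      (measurable_orthoTube_right (L := L) 1))) (C := CΩ * (1 + β * R ^ 2) ^ K * BR) fun v => by
        rw [abs_mul]; exact mul_le_mul (hΩKb _) (hBR _ _) (abs_nonneg _) ((abs_nonneg _).trans (hΩKb 0))
  have hI3 : Integrable (fun v => (β ^ (k + j))⁻¹ * ((β ^ a)⁻¹ * (Ω (linkEmbed L v) * (1 + β * ‖linkEmbed L v‖ ^ 2) ^ K *
      fpFibreTransfer L β (fun x => Ω x * (1 + β * ‖x‖ ^ 2) ^ K) (fun g => W g * (1 + β * ∑ x, ‖su2Quat (g x) - 1‖ ^ 2) ^ j) (orthoTube L 1 v) 1)))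
      (orthoTransverse L) := (hI3'.const_mul _).const_mul _
  have step := integral_mono hI1 hI3 fun v => by
    have hT0 : 0 ≤ fpFibreTransfer L β (fun x => Ω x * (1 + β * ‖x‖ ^ 2) ^ K) (fun g => W g * (1 + β * ∑ x, ‖su2Quat (g x) - 1‖ ^ 2) ^ j) (orthoTube L 1 v) 1 :=
      fpFibreTransfer_nonneg β hΩK0 hWr0 _ _
    have h1 := mul_le_mul_of_nonneg_left (hpt (orthoTube L 1 v)) (hΩa0 (linkEmbed L v))
    have h2 := mul_le_mul_of_nonneg_right (hΩaK (linkEmbed L v)) hT0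
    show Ωa (linkEmbed L v) * fpFibreTransfer L β (fun x => Ω x * (‖x‖ ^ 2) ^ k) (fun g => W g * (∑ x, ‖su2Quat (g x) - 1‖ ^ 2) ^ j) (orthoTube L 1 v) 1 ≤
      (β ^ (k + j))⁻¹ * ((β ^ a)⁻¹ * (Ω (linkEmbed L v) * (1 + β * ‖linkEmbed L v‖ ^ 2) ^ K *
        fpFibreTransfer L β (fun x => Ω x * (1 + β * ‖x‖ ^ 2) ^ K) (fun g => W g * (1 + β * ∑ x, ‖su2Quat (g x) - 1‖ ^ 2) ^ j) (orthoTube L 1 v) 1))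
    have hβkj : 0 ≤ (β ^ (k + j))⁻¹ := inv_nonneg.mpr (pow_nonneg hβ0 _)
    nlinarith
  refine step.trans ?_
  rw [integral_const_mul, integral_const_mul]
  have e : (β ^ (a + k + j))⁻¹ = (β ^ (k + j))⁻¹ * (β ^ a)⁻¹ := by rw [show a + k + j = (k + j) + a by ring, pow_add, mul_inv]
  rw [e, mul_assoc]
  refine mul_le_mul_of_nonneg_left (mul_le_mul_of_nonneg_left ?_ (inv_nonneg.mpr (pow_nonneg hβ0 _))) (inv_nonneg.mpr (pow_nonneg hβ0 _))
  exact integral_profile_mul_fpFibreTransfer_le_fpBOKernel β hΩKm hΩKm hΩKm hΩKb hΩKb hΩKb hΩK0 hΩK0 (fun x => le_rfl) (fun x => le_rfl) hWrm hWrb hWr0 1 1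

end Summit.QuantumFields.YangMills.Theorems.FemtoTransferGap.TwoLattice.ConstTube

end
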